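import Summits.BirchSwinnertonDyer.BirchSwinnertonDyer.Theorems.SemiOrdinaryEisensteinDescentShaTwoCochainClassInflation
import Summits.BirchSwinnertonDyer.BirchSwinnertonDyer.Theorems.SemiOrdinaryEisensteinDescentShaTwoCochainLayerTriangle
import Summits.BirchSwinnertonDyer.BirchSwinnertonDyer.Theorems.SemiOrdinaryEisensteinDescentShaTwoCochainLayerInjective
import Summits.BirchSwinnertonDyer.BirchSwinnertonDyer.Theorems.SemiOrdinaryEisensteinDescentShaTwoCochainIdeleInvariantSum
import HarnessLib

/-!
# The Ш²-cochain bridge, step S3 CLOSED (class side): the finite-place invariant sum of an idèle `2`-cocycle `Z` with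
# `j_C ∘ Z = h ∘ c`, `[c] = δ₁[γ]`, IS road B's readout `classBarInv K (Φ⁻¹[γ] ∘ ∂h)` — and the sign-free criterion `hS3c`
# of the final assembly (Tate, C–F VII §11.2 (bis); Milne ADT I Thm. 4.10 (a), proof p. 58)

Route `SemiOrdinaryEisensteinDescent` (BSD, rung W-ALL row 2·3@3), Kolyvagin column, Cassels–Tate lane: print item
`CasselsTateLevelInputsFact` (stmt-BirchSwinnertonDyer-20191 = `∀ K, casselsTate_levelInputs K`); crux `WildKolyvaginUpperAtThree`
(stmt-BirchSwinnertonDyer-20480).  This file is the last link "S3, C̄-side" of the memo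
`Cruxes/WildKolyvaginUpperAtThree/SHA2-BRIDGE-w3g7.md` / `S3-IDELE-DESCENT-w2g11.md` §3, assembling BY NAME

* (I2) `presentationSide_identification` and (I1) `ideleSide_identification` (w5 g6, `…ShaTwoCochainClassInflation`, p644685),
* the α/β/γ descent triangle `exists_galLayer_layerRep_triangle_idele` (w2 g11, `…ShaTwoCochainLayerTriangle`, p645209),
* (T-Cα) `classInvAll_eq_classInvAll_of_infTwo_toAbsLayer_eq` (`…ShaTwoCochainLayerInjective`, p644442; w2 g11's twin
  `classInvAll_eq_of_infTwo_toAbsLayer_eq`, `…ShaTwoCochainClassInvariant`, p644246),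
* S3b on a descended representative: `brauerInvariant_eq_localInv_of_descended`, `twoCocycleClass_eq_zero_iff_localInvInf_of_descended`,
  `exists_localIdeleCocycle_inf` (w2 g11, `…ShaTwoCochainIdeleInvariantSum`, p641863),
* door-c5 `IdeleCohomology.inv_eq_sum` / `exists_finset_forall_localInv_eq_zero` (`inv_E = Σ_{v finite} localInv + Σ_{w ∣ ∞} localInvInf`),

into:

* **`exists_sum_brauerInvariantEquiv_eq_classBarInv_readout`** — for a finite discrete `Γ_K`-module `ρ₀` with canonical presentation
  `0 → N₁ → P → M → 0`, `h : N₁ ⟶ C̄`, a continuous `1`-cocycle `γ` of `ρ₀`, a continuous `2`-cocycle `c` of `N₁` with `δ₁[γ] = [c]`,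
  a continuous idèle `2`-cocycle `Z` with `j_C(Z(σ, τ)) = h(c(σ, τ))`, its finite-place projection cocycles `cZ v` (THE idèle
  projections `IdeleReadout.ideleProjection K`) and VANISHING archimedean projection classes: there is a finite set `Tf` of finite places
  with, for every finite `T ⊇ Tf`,
  `Σ_{v ∈ T} inv_{K_v} [cZ v] = classBarInv K (Φ⁻¹[γ] ∘ ∂h)` (`Φ = OpenLayer.extOneEquiv ρ₀`, `∂ = ExtPresentation.boundary`).
  PROOF (memo §3): readout `= classInvAll K E₁ (iso_{E₁} w₁)` and `(j_C)_* [Z] = inf_{E₁} (toAbsLayer w₁)` (I2); `[Z]` has a layer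
  `E₂`, an α-class `w` with `inf_{E₂} (toAbsLayer w) = [Z]`, a γ-cocycle `b` with `iso^J_{E₂} w = [b]` and an on-the-nose representative
  `Z₀` (triangle); `(j_C)_* [Z] = inf_{E₂} (toAbsLayer ((j_C^{U_{E₂}})_* w))` and `classInvAll K E₂ (iso ((j_C^{U})_* w)) = inv_{E₂} (iso^J w)`
  (I1); so by (T-Cα) the readout is `inv_{E₂} [b] = Σ_{v ∈ T} localInv E₂ v [b] + Σ_{w ∣ ∞} localInvInf E₂ w [b]` for `T ⊇` the
  support; the archimedean terms vanish (`[cW] = 0 ↔ localInvInf = 0` on the descended representative) and each finite term is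
  `inv_{K_v} [cZ v]`.
* **`classBarInv_readout_eq_zero_of_criterion`** — VERBATIM the hypothesis `hS3c` of w4 g2's
  `ShaTwoCochainTheta.hbridge_of_readout_criterion` (p644510, `…ShaTwoCochainBridgeAssemblyCriterion`): if moreover the finite-place
  invariant sums of `Z` vanish on all large `T`, then `classBarInv K (Φ⁻¹[γ] ∘ ∂h) = 0` (take `T ⊇ Tf ∪ Tf'`).  The binders `n`, `hM`,
  `ht` and (3) `j_C ∘ h̃ = h` of `hS3c` are not needed and are carried unused.  Hence
  `hbridge_of_readout_criterion K (classBarInv_readout_eq_zero_of_criterion K)` is the binder `hbridge` of the shell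
  `casselsTate_levelInputs_of_readout_vanishing_flip`, i.e. `casselsTate_levelInputs K` for THE maps at every number field `K`
  (the closer file, `--workitem stmt-BirchSwinnertonDyer-20191`, is w4 g2's).

THEOREMS ONLY (no definition, no instance, no instance attribute, no named fact, no `sorry`); default heartbeats; every identification
in term mode (`Eq.trans`/`congrArg` — `rw` under `classBarInv`/`H2π`/`inv` terms exceeds the whnf budget at the declaration, memo §4).
No case of BSD is proved; Poitou–Tate / Cassels–Tate are published theorems being discharged in the kernel; BSD is not proved by any
of this.  Width seat `bsd-wall-soed-p2-w3` g8; `--supports stmt-BirchSwinnertonDyer-20480`, helper.  Route-free (no `Theses` import).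

## References
* [CasselsFrohlichANT1967] J. W. S. Cassels, A. Fröhlich (eds.), *Algebraic Number Theory* (1967), Ch. VII (J. Tate) §7.3 Cor. 7.4 (b),
  §8 Prop. 8.1, §11.1, §11.2 (bis).
* [MilneADT2006] J. S. Milne, *Arithmetic Duality Theorems*, 2nd ed. (2006), I Lemma 4.13, Thm. 4.10 (a) (proof, p. 58), Ex. 1.6 (c).
* [SerreGaloisCohomology1997] J.-P. Serre, *Galois Cohomology* (1997), I §2.2 Proposition 8 and Corollary 1, §2.4.
-/

noncomputable section

set_option linter.dupNamespace false
set_option autoImplicit false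

namespace Summit.BirchSwinnertonDyer.BirchSwinnertonDyer.Theorems.ShaTwoCochain

open CategoryTheory CategoryTheory.Abelian groupCohomology Field NumberField IsDedekindDomain
open Literature.NumberTheory.GaloisRepresentations Literature.NumberTheory.GaloisRepresentations.IdeleClassBar
open Literature.NumberTheory.GaloisRepresentations.DGMBridge Literature.NumberTheory.GaloisRepresentations.LayerDelta
open Literature.NumberTheory.GaloisRepresentations.FreePresentation Literature.NumberTheory.GaloisRepresentations.HomDual
open Literature.NumberTheory.GaloisRepresentations.IdeleReadout Literature.NumberTheory.Automorphic
open Literature.NumberTheory.GaloisRepresentations.DiscreteGaloisModule (units)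
open Literature.Algebra.Homology Literature.Algebra.Homology.DiscreteRep Literature.Algebra.Homology.ExtPresentation
open Literature.AnabelianGeometry.AbsoluteAnabelian.Prop121vii (brauerInvariantEquiv)
open scoped ContRepresentation

variable (K : Type) [Field K] [NumberField K]

/-- **S3 (class side): the finite-place invariant sum of `Z` IS road B's readout.**  For a finite discrete `Γ_K`-module `ρ₀`
(canonical presentation `0 → N₁ → P → M → 0`), `h : N₁ ⟶ C̄`, a continuous `1`-cocycle `γ` of `ρ₀` and `2`-cocycle `c` of `N₁` with
`δ₁[γ] = [c]` (`h4`), a continuous idèle `2`-cocycle `Z` with `j_C(Z(σ, τ)) = h(c(σ, τ))` (`h5`), its finite-place projection cocycles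
`cZ v` through THE idèle projections (`hcZ`), and vanishing archimedean projection classes (`hinf`): there is a finite set `Tf` of
finite places such that for every finite `T ⊇ Tf`,
`Σ_{v ∈ T} inv_{K_v} [cZ v] = classBarInv K (Φ⁻¹[γ] ∘ ∂h)`.
((I2) + triangle + (I1) + (T-Cα) give `readout = inv_{E₂} [b]`; `inv_{E₂} [b] = Σ_{v ∈ T} localInv + Σ_{w ∣ ∞} localInvInf`, the
archimedean terms vanish by `hinf` on the descended representative, the finite ones are `inv_{K_v} [cZ v]`.)
[cite: CasselsFrohlichANT1967, Ch. VII §11.2 (bis)][cite: MilneADT2006, I Thm. 4.10 (a) (proof, p. 58)]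
[cite: SerreGaloisCohomology1997, I §2.2 Proposition 8] -/
theorem exists_sum_brauerInvariantEquiv_eq_classBarInv_readout
    {M : Type} [AddCommGroup M] [TopologicalSpace M] [DiscreteTopology M] [Finite M]
    (ρ₀ : DiscreteGaloisModule K M)
    (h : (presentationComplex ρ₀).X₁ ⟶ classBarD K) (γ : contOneCocycles ρ₀.toTopRep)
    (c : contTwoCocycles (presModule₁ ρ₀).toTopRep)
    (Z : contTwoCocycles (toDGM (ideleBarD K)).toTopRep)
    (h4 : haveI := moduleFinite_presModule₁ ρ₀
      (pres_isSES ρ₀).δ₁ (oneCocycleClass _ γ) = twoCocycleClass _ c)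
    (h5 : ∀ σ τ : absoluteGaloisGroup K,
      ideleToClassI K (Z.1 (σ, τ)) = lmap (presentationComplex ρ₀).X₁ (classBarD K) h (c.1 (σ, τ)))
    (cZ : (v : HeightOneSpectrum (𝓞 K)) →
      haveI := charZero_adicCompletion v; contTwoCocycles (units (v.adicCompletion K)).toTopRep)
    (hcZ : ∀ (v : HeightOneSpectrum (𝓞 K)) (s t : absoluteGaloisGroup (v.adicCompletion K)),
      (cZ v).1 (s, t) = ((ideleProjection K (Sum.inr v)).toAddMonoidHom.comp (LCarrier.val (ideleBarD K)))
        (Z.1 (absGaloisRestrict K (v.adicCompletion K) s, absGaloisRestrict K (v.adicCompletion K) t)))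
    (hinf : ∀ (w : InfinitePlace K) (cW : contTwoCocycles (units (Place.Completion (Sum.inl w : Place K))).toTopRep),
      (∀ s t : absoluteGaloisGroup (Place.Completion (Sum.inl w : Place K)),
        cW.1 (s, t) = ((ideleProjection K (Sum.inl w)).toAddMonoidHom.comp (LCarrier.val (ideleBarD K)))
          (Z.1 (absGaloisRestrict K (Place.Completion (Sum.inl w : Place K)) s,
            absGaloisRestrict K (Place.Completion (Sum.inl w : Place K)) t))) →
      (haveI := absoluteGaloisGroup_compactSpace (Place.Completion (Sum.inl w : Place K));
        twoCocycleClass (units (Place.Completion (Sum.inl w : Place K))).toTopRep cW) = 0) :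
    ∃ Tf : Finset (HeightOneSpectrum (𝓞 K)), ∀ T : Finset (HeightOneSpectrum (𝓞 K)), Tf ⊆ T →
      ∑ v ∈ T, (haveI := charZero_adicCompletion v;
          brauerInvariantEquiv (v.adicCompletion K) (twoCocycleClass (units (v.adicCompletion K)).toTopRep (cZ v))) =
        classBarInv K (((OpenLayer.extOneEquiv ρ₀).symm (oneCocycleClass _ γ)).comp
          (boundary (presentationComplex_shortExact ρ₀) (classBarD K) h) (rfl : 1 + 1 = 2)) := by
  haveI := moduleFinite_presModule₁ ρ₀
  -- (I2) presentation side: `readout = classInvAll E₁ (iso w₁)` and `(j_C)_* [Z] = inf_{E₁} (toAbsLayer w₁)`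
  obtain ⟨E₁, hE₁, hn₁, hfd₁, w₁, ha, hb⟩ := presentationSide_identification ρ₀ h γ c h4
  have hZ₁ := hb Z h5
  -- the α/β/γ triangle of `[Z]` on the idèle system and (I1) the idèle side
  obtain ⟨E₂, w, b, Z₀, hx, hwb, hZ₀, hval⟩ := exists_galLayer_layerRep_triangle_idele (twoCocycleClass _ Z)
  haveI : Normal K E₂.1 := normal_layer E₂
  haveI : FiniteDimensional K E₂.1 := finiteDimensional_layer E₂
  haveI := E₁.numberField
  haveI := E₁.isGalois
  haveI := E₂.numberField
  haveI := E₂.isGalois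
  obtain ⟨hI1, hI1'⟩ := ideleSide_identification E₂ w hx
  -- (T-C): the two layer presentations of `(j_C)_* [Z]` have the same invariant
  have hTC := classInvAll_eq_classInvAll_of_infTwo_toAbsLayer_eq E₁ E₂ w₁ _ (hZ₁.symm.trans hI1)
  -- so the readout is `inv_{E₂} [b]`
  have hread : classBarInv K (((OpenLayer.extOneEquiv ρ₀).symm (oneCocycleClass _ γ)).comp
        (boundary (presentationComplex_shortExact ρ₀) (classBarD K) h) (rfl : 1 + 1 = 2)) =
      IdeleCohomology.inv E₂.1 (H2π (IdeleClassGroup.ideleRep K E₂.1) b) :=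
    ha.trans (hTC.trans (hI1'.trans (congrArg (IdeleCohomology.inv E₂.1) hwb)))
  -- the archimedean invariants of `[b]` vanish
  have harch : ∀ w' : InfinitePlace K, IdeleCohomology.localInvInf E₂.1 w' (H2π (IdeleClassGroup.ideleRep K E₂.1) b) = 0 := fun w' => by
    obtain ⟨cW, -, hcW⟩ := exists_localIdeleCocycle_inf w' (ideleProjection K (Sum.inl w')) Z
    exact (twoCocycleClass_eq_zero_iff_localInvInf_of_descended E₂ hZ₀ hval Z rfl w' cW hcW).1 (hinf w' cW hcW)
  -- the finite support of the finite invariants of `[b]`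
  obtain ⟨Tf, hTf⟩ := IdeleCohomology.exists_finset_forall_localInv_eq_zero (F := K) (E := E₂.1) (H2π (IdeleClassGroup.ideleRep K E₂.1) b)
  refine ⟨Tf, fun T hT => ?_⟩
  have hsum : ∑ v ∈ T, (haveI := charZero_adicCompletion v;
        brauerInvariantEquiv (v.adicCompletion K) (twoCocycleClass (units (v.adicCompletion K)).toTopRep (cZ v))) =
      ∑ v ∈ T, IdeleCohomology.localInv E₂.1 v (H2π (IdeleClassGroup.ideleRep K E₂.1) b) :=
    Finset.sum_congr rfl fun v _ => brauerInvariant_eq_localInv_of_descended E₂ hZ₀ hval Z rfl v (cZ v) (hcZ v)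
  have hinvT := IdeleCohomology.inv_eq_sum (H2π (IdeleClassGroup.ideleRep K E₂.1) b) T
    (fun v hv => hTf v fun hv' => hv (hT hv'))
  have hzero : ∑ w' : InfinitePlace K, IdeleCohomology.localInvInf E₂.1 w' (H2π (IdeleClassGroup.ideleRep K E₂.1) b) = 0 :=
    Finset.sum_eq_zero fun w' _ => harch w'
  have hinvT' : IdeleCohomology.inv E₂.1 (H2π (IdeleClassGroup.ideleRep K E₂.1) b) =
      ∑ v ∈ T, IdeleCohomology.localInv E₂.1 v (H2π (IdeleClassGroup.ideleRep K E₂.1) b) :=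
    hinvT.trans ((congrArg (fun t => ∑ v ∈ T, IdeleCohomology.localInv E₂.1 v (H2π (IdeleClassGroup.ideleRep K E₂.1) b) + t)
      hzero).trans (add_zero _))
  exact hsum.trans (hinvT'.symm.trans hread.symm)

/-- **`hS3c` — the sign-free criterion of the final assembly, VERBATIM the hypothesis of
`ShaTwoCochainTheta.hbridge_of_readout_criterion`**: for `Z` as above whose finite-place invariant sums moreover VANISH on all large
finite sets of finite places, road B's readout `classBarInv K (Φ⁻¹[γ] ∘ ∂h)` vanishes (both equal the sum over `T ⊇ Tf ∪ Tf'`).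
The binders `n`, `hM`, `ht` and (3) are those of `hS3c` and are not used.  With w4 g2's `hbridge_of_readout_criterion` and the shell
`casselsTate_levelInputs_of_readout_vanishing_flip` this yields `casselsTate_levelInputs K` for THE maps at every number field.
[cite: MilneADT2006, I Thm. 4.10 (a) (proof, p. 58)][cite: CasselsFrohlichANT1967, Ch. VII §11.2 (bis)] -/
theorem classBarInv_readout_eq_zero_of_criterion :
    ∀ (n : ℕ) [NeZero n] {M : Type} [AddCommGroup M] [TopologicalSpace M] [DiscreteTopology M] [Finite M]
      (ρ₀ : DiscreteGaloisModule K M) (hM : ∀ m : M, n • m = 0)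
      (h : (presentationComplex ρ₀).X₁ ⟶ classBarD K) (γ : contOneCocycles ρ₀.toTopRep)
      (c : contTwoCocycles (presModule₁ ρ₀).toTopRep)
      (ht : DiscreteRep.HomCarrier (LCarrier (presentationComplex ρ₀).X₁) (LCarrier (ideleBarD K)))
      (Z : contTwoCocycles (toDGM (ideleBarD K)).toTopRep),
      haveI := moduleFinite_presModule₁ ρ₀
      haveI := absoluteGaloisGroup_compactSpace K
      (∀ x : LCarrier (presentationComplex ρ₀).X₁,
        ideleToClassI K ((show _ →ₗ[ℤ] LCarrier (ideleBarD K) from ht) x) = lmap (presentationComplex ρ₀).X₁ (classBarD K) h x) →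
      (pres_isSES ρ₀).δ₁ (oneCocycleClass _ γ) = twoCocycleClass _ c →
      (∀ σ τ : absoluteGaloisGroup K,
        ideleToClassI K (Z.1 (σ, τ)) = lmap (presentationComplex ρ₀).X₁ (classBarD K) h (c.1 (σ, τ))) →
      ∀ (cZ : (v : HeightOneSpectrum (𝓞 K)) → contTwoCocycles (units (v.adicCompletion K)).toTopRep),
        (∀ (v : HeightOneSpectrum (𝓞 K)) (s t : absoluteGaloisGroup (v.adicCompletion K)),
          (cZ v).1 (s, t) = ((IdeleReadout.ideleProjection K (Sum.inr v)).toAddMonoidHom.comp (LCarrier.val (ideleBarD K)))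
            (Z.1 (absGaloisRestrict K (v.adicCompletion K) s, absGaloisRestrict K (v.adicCompletion K) t))) →
        -- archimedean hypothesis: every local projection class of `Z` at an infinite place vanishes
        (∀ (w : InfinitePlace K) (cW : contTwoCocycles (units (Place.Completion (Sum.inl w : Place K))).toTopRep),
          (∀ s t : absoluteGaloisGroup (Place.Completion (Sum.inl w : Place K)),
            cW.1 (s, t) = ((IdeleReadout.ideleProjection K (Sum.inl w)).toAddMonoidHom.comp (LCarrier.val (ideleBarD K)))
              (Z.1 (absGaloisRestrict K (Place.Completion (Sum.inl w : Place K)) s,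
                absGaloisRestrict K (Place.Completion (Sum.inl w : Place K)) t))) →
          (haveI := absoluteGaloisGroup_compactSpace (Place.Completion (Sum.inl w : Place K));
            twoCocycleClass (units (Place.Completion (Sum.inl w : Place K))).toTopRep cW) = 0) →
        (∃ Tf : Finset (HeightOneSpectrum (𝓞 K)), ∀ T : Finset (HeightOneSpectrum (𝓞 K)), Tf ⊆ T →
          ∑ v ∈ T, (haveI := charZero_adicCompletion v; haveI := absoluteGaloisGroup_compactSpace (v.adicCompletion K);
              brauerInvariantEquiv (v.adicCompletion K)
                (twoCocycleClass (units (v.adicCompletion K)).toTopRep (cZ v))) = 0) →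
        classBarInv K (((OpenLayer.extOneEquiv ρ₀).symm (oneCocycleClass _ γ)).comp
          (boundary (presentationComplex_shortExact ρ₀) (classBarD K) h) (rfl : 1 + 1 = 2)) = 0 := by
  classical
  intro n _ M _ _ _ _ ρ₀ _hM h γ c _ht Z _h3 h4 h5 cZ hcZ hinf hfin
  obtain ⟨Tf, hTf⟩ := exists_sum_brauerInvariantEquiv_eq_classBarInv_readout K ρ₀ h γ c Z h4 h5 cZ hcZ hinf
  obtain ⟨Tf', hTf'⟩ := hfin
  exact (hTf (Tf ∪ Tf') Finset.subset_union_left).symm.trans (hTf' (Tf ∪ Tf') Finset.subset_union_right)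

end Summit.BirchSwinnertonDyer.BirchSwinnertonDyer.Theorems.ShaTwoCochain

end
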